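import Literature.Computability.Complexity.KannanLanguage
import Literature.Computability.Complexity.CircuitSizeProofs
import Literature.Computability.Complexity.ExpClosure
import HarnessLib

/-!
# Kannan's diagonal language: almost-everywhere hardness and membership in `EXP`

`KannanLanguage.lean` defines Kannan's diagonal language `Kannan.lang k` (Kannan 1982, Lemma 1),
proves `lang k ∈ Σ₄ᵖ` (`Kannan.lang_mem_SigmaP_four`) and the lower bound in the
infinitely-often form `lang k ∉ SIZE(c·n^k + c)` (`Kannan.lang_not_mem_SIZE`: at ONE good length
the `n`-th circuit of a small family is diagonalised against). The construction is in fact hard at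
EVERY large length — Kannan, p. 44: "for each `n` sufficiently large, `L_k ∩ {0,1}ⁿ` cannot be
accepted by a circuit of size `n^{k+1}` or less" — and this file records that almost-everywhere
form with the circuit complexity function `Language.circuitSize`:

* `Kannan.lt_circuitSize_of_good_length` — per-length form of `Kannan.not_decides_of_good_length`:
  at a length `n` with `(s+1)(8(n+s)+10) ≤ n^{2k+2}` and `n^{2k+2} + 1 ≤ 2ⁿ`, the slice of `L_k`
  has circuit complexity `> s` (the optimal `B₂`-circuit, `exists_circuit_size_eq_circuitSize`,
  has a short description, which the least hard table defeats on a live input);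
* `Kannan.eventually_good_length` — for `s = n^c` and `k = c + 1` every `n ≥ max 4 N` is good
  (`52·n^{2c+1} ≤ n^{2c+4}`; `n^{2c+4} < 2ⁿ` eventually, from
  `TimeConstructible.exists_pow_le_mul_two_pow`);
* `Kannan.eventually_pow_lt_circuitSize` — `∀ᶠ n, n^c < circuitSize (L_{c+1}) n`;
* `SigmaP_subset_EXP`, `PH_subset_EXP` — `Σₖᵖ ⊆ EXP` by induction on `k` from the proved closure
  `∃ᵖ·EXP ⊆ EXP` (`polyExists_EXP_subset_EXP`, `ExpClosure.lean`) and `co EXP = EXP`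
  (Arora–Barak 2009, §5.2: `PH ⊆ PSPACE ⊆ EXP`; here directly by certificate enumeration);
* `Kannan.lang_mem_EXP` and the packaged statement
  `exists_mem_EXP_eventually_lt_circuitSize : ∀ c, ∃ L ∈ EXP, ∀ᶠ n, n^c < L.circuitSize n`,
  i.e. **`EXP ⊄ io-SIZE(n^c)` for every fixed `c`** with the almost-everywhere `SIZE` of
  Impagliazzo–Kabanets–Wigderson 2002 (their Thm. 2, proved there by the lexicographically first
  hard circuit; here by Kannan's least hard table) — the statement of the named fact
  `IKW2002_thm2` of the easy-witness decomposition of `NEXP ⊆ P/poly ⟹ NEXP = EXP`.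

Everything is proved; no machine is programmed here (the `Σ₄ᵖ` sentence of `KannanLanguage.lean`
and the exhaustive-search closure of `ExpClosure.lean` do the work).

## References

* R. Kannan, *Circuit-size lower bounds and non-reducibility to sparse sets*, Inform. Control 55
  (1982) 40–56, Lemma 1 and its proof (pp. 43–44: "for each `n` sufficiently large").
* R. Impagliazzo, V. Kabanets, A. Wigderson, *In search of an easy witness: exponential time vs.
  probabilistic polynomial time*, JCSS 65 (2002) 672–694, Thm. 2 (`EXP ⊄ io-SIZE(n^c)`).
* S. Arora, B. Barak, *Computational Complexity: A Modern Approach*, CUP 2009, §5.2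
  (`PH ⊆ PSPACE`), Claim 2.4 (certificate enumeration), Thm. 6.21–6.22 and Ex. 6.5–6.6
  (counting, Kannan's theorem).
-/

namespace Literature.Computability.Complexity

open Filter

/-! ### `Σₖᵖ ⊆ EXP` -/

/-- `co EXP = EXP`: deterministic exponential time is closed under complement.
[cite: AroraBarakCC2009, §2.6.2] -/
theorem co_EXP : co EXP = EXP :=
  co_eq_self_of_compl_mem_iff fun _ => compl_mem_EXP_iff

/-- **`Σₖᵖ ⊆ EXP`** for every `k`: `Σ₀ᵖ = P ⊆ EXP`, and `Σₖ₊₁ᵖ = ∃ᵖ·coΣₖᵖ ⊆ ∃ᵖ·EXP ⊆ EXP` by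
exhaustive search over the polynomially bounded certificates (`polyExists_EXP_subset_EXP`).
(Arora–Barak: `PH ⊆ PSPACE ⊆ EXP`, §5.2 with Claim 2.4.) [cite: AroraBarakCC2009, §5.2] -/
theorem SigmaP_subset_EXP (k : ℕ) : SigmaP k ⊆ EXP := by
  induction k with
  | zero => exact P_subset_EXP
  | succ k ih =>
    change polyExists (co (sigmaP Classes.P k)) ⊆ EXP
    exact (polyExists_mono ((co_mono ih).trans co_EXP.subset)).trans polyExists_EXP_subset_EXP

/-- **`PH ⊆ EXP`**. [cite: AroraBarakCC2009, §5.2] -/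
theorem PH_subset_EXP : PH ⊆ EXP :=
  Set.iUnion_subset SigmaP_subset_EXP

namespace Kannan

open CircEval

/-- Kannan's language is in `EXP` (`Σ₄ᵖ ⊆ EXP`). [cite: Kannan1982, Lemma 1] -/
theorem lang_mem_EXP (k : ℕ) : lang k ∈ EXP :=
  SigmaP_subset_EXP 4 (lang_mem_SigmaP_four k)

/-! ### Almost-everywhere hardness -/

/-- Consistency of a circuit computing the slice of `L_k` at length `|z|` with the least hard
table `T` at that length: its description accepts `z` iff `T[bitsToNat z] = 1` (per-circuit form
of `descAccepts_desc_eq_getD`). [cite: Kannan1982, Lemma 1 (proof)] -/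
theorem descAccepts_desc_eq_of_computes {k : ℕ} (z : List Bool) (C : Circuit (Fin z.length))
    (hCB : C.IsOver B2) (hCf : C.Computes ((lang k).sliceFn z.length)) {T : List Bool}
    (hT : IsMinHard k z.length T) :
    descAccepts (desc C) z = T.getD (bitsToNat z) false := by
  rw [descAccepts_desc z C hCB, hCf z.get]
  change (lang k).boolIndicator (List.ofFn z.get) = _
  rw [List.ofFn_get]
  by_cases hz : z ∈ lang k
  · rw [(Set.mem_iff_boolIndicator _ _).1 hz, (mem_lang_iff hT).1 hz]
  · rw [(Set.notMem_iff_boolIndicator _ _).1 hz]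
    have : ¬ T.getD (bitsToNat z) false = true := fun h => hz ((mem_lang_iff hT).2 h)
    simpa using this

/-- The same for a circuit on `n` inputs and any `z` of length `n`. [cite: Kannan1982, Lemma 1 (proof)] -/
theorem descAccepts_desc_eq_of_computes_of_length_eq {k n : ℕ} (C : Circuit (Fin n))
    (hCB : C.IsOver B2) (hCf : C.Computes ((lang k).sliceFn n)) {T : List Bool}
    (hT : IsMinHard k n T) (z : List Bool) (hz : z.length = n) :
    descAccepts (desc C) z = T.getD (bitsToNat z) false := by
  subst hz
  exact descAccepts_desc_eq_of_computes z C hCB hCf hT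

/-- **A good length defeats every small circuit** (per-length form of
`not_decides_of_good_length`; Kannan p. 44: "for each `n` sufficiently large, `L_k ∩ {0,1}ⁿ`
cannot be accepted by a circuit of size `n^{k+1}` or less"): if `(s+1)(8(n+s)+10) ≤ n^{2k+2}` and
`n^{2k+2} + 1 ≤ 2ⁿ` then the circuit complexity of `L_k` at length `n` exceeds `s` — an optimal
`B₂`-circuit of size `≤ s` would have a description of length `≤ n^{2k+2}`, which the least hard
table defeats on some live input `y0^{n-|y|}`. [cite: Kannan1982, Lemma 1 (proof)] -/
theorem lt_circuitSize_of_good_length {k s n : ℕ}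
    (hA : (s + 1) * (8 * (n + s) + 10) ≤ bound k n) (hB : bound k n + 1 ≤ 2 ^ n) :
    s < (lang k).circuitSize n := by
  by_contra hle
  rw [not_lt] at hle
  obtain ⟨C, hCB, hCf, hCs⟩ := exists_circuit_size_eq_circuitSize (lang k) n
  obtain ⟨T, hT⟩ := exists_isMinHard (exists_isHard k n hB)
  have hsize : C.size ≤ s := hCs ▸ hle
  have hD : (desc C).length ≤ bound k n := (length_desc_le_of_size_le C hsize).trans hA
  obtain ⟨y, hy, -, hne⟩ := hT.1.2 (desc C) hD
  refine hne ?_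
  rw [descAccepts_desc_eq_of_computes_of_length_eq C hCB hCf hT (pad n y) (length_pad hy),
    bitsToNat_pad]

/-- Polynomial versus exponential, eventually: `n^d + 1 ≤ 2ⁿ` for all large `n`. [folklore] -/
theorem eventually_pow_succ_le_two_pow (d : ℕ) : ∀ᶠ n in atTop, n ^ d + 1 ≤ 2 ^ n := by
  obtain ⟨C, hC⟩ := TimeConstructible.exists_pow_le_mul_two_pow (d + 1)
  refine eventually_atTop.2 ⟨2 * C + 2, fun n hn => ?_⟩
  have h1 : (2 * C + 2) * n ^ d ≤ C * 2 ^ n :=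
    (Nat.mul_le_mul_right _ hn).trans (by simpa [pow_succ, mul_comm] using hC n)
  have h2 : 1 ≤ n ^ d := Nat.one_le_pow _ _ (by omega)
  by_contra h
  rw [not_le] at h
  nlinarith

/-- **Good lengths, eventually**: with `k = c + 1`, every large `n` satisfies
`(n^c + 1)(8(n + n^c) + 10) ≤ n^{2k+2} = n^{2c+4}` (indeed `≤ 52·n^{2c+1}`, and `52 ≤ n³` for
`n ≥ 4`) and `n^{2c+4} + 1 ≤ 2ⁿ`. [folklore] -/
theorem eventually_good_length (c : ℕ) :
    ∀ᶠ n in atTop, (n ^ c + 1) * (8 * (n + n ^ c) + 10) ≤ bound (c + 1) n ∧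
      bound (c + 1) n + 1 ≤ 2 ^ n := by
  have hb : ∀ n, bound (c + 1) n = n ^ (2 * c + 4) := fun n => by
    rw [bound]; ring_nf
  refine ((eventually_ge_atTop 4).and (eventually_pow_succ_le_two_pow (2 * c + 4))).mono
    fun n ⟨hn, h2⟩ => ⟨?_, by rwa [hb]⟩
  rw [hb]
  have hn1 : 1 ≤ n := by omega
  have hp : 1 ≤ n ^ c := Nat.one_le_pow _ _ hn1
  have hq : n ≤ n ^ (c + 1) := by
    calc n = n ^ 1 := (pow_one n).symm
      _ ≤ n ^ (c + 1) := Nat.pow_le_pow_right hn1 (by omega)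
  have hr : n ^ c ≤ n ^ (c + 1) := Nat.pow_le_pow_right hn1 (by omega)
  have h1 : n ^ c + 1 ≤ 2 * n ^ c := by omega
  have h2 : 8 * (n + n ^ c) + 10 ≤ 26 * n ^ (c + 1) := by omega
  have h3 : 64 ≤ n ^ 3 := by
    calc (64 : ℕ) = 4 ^ 3 := by norm_num
      _ ≤ n ^ 3 := Nat.pow_le_pow_left hn 3
  calc (n ^ c + 1) * (8 * (n + n ^ c) + 10) ≤ 2 * n ^ c * (26 * n ^ (c + 1)) :=
        Nat.mul_le_mul h1 h2
    _ = 52 * n ^ (2 * c + 1) := by ring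
    _ ≤ n ^ 3 * n ^ (2 * c + 1) := Nat.mul_le_mul_right _ (by omega)
    _ = n ^ (2 * c + 4) := by rw [← pow_add]; ring_nf

/-- **Kannan's language `L_{c+1}` is hard at almost every length**: `n^c < circuitSize (L_{c+1}) n`
for all sufficiently large `n` (Kannan 1982, proof of Lemma 1: "for each `n` sufficiently large").
[cite: Kannan1982, Lemma 1] -/
theorem eventually_pow_lt_circuitSize (c : ℕ) :
    ∀ᶠ n in atTop, n ^ c < (lang (c + 1)).circuitSize n :=
  (eventually_good_length c).mono fun _ h => lt_circuitSize_of_good_length h.1 h.2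

/-- `Σ₄ᵖ` contains, for every `c`, a language whose circuit complexity exceeds `n^c` at almost
every length (the almost-everywhere form of Kannan's Lemma 1). [cite: Kannan1982, Lemma 1] -/
theorem exists_mem_SigmaP_four_eventually_lt_circuitSize (c : ℕ) :
    ∃ L ∈ SigmaP 4, ∀ᶠ n in atTop, n ^ c < L.circuitSize n :=
  ⟨lang (c + 1), lang_mem_SigmaP_four (c + 1), eventually_pow_lt_circuitSize c⟩

end Kannan

/-- **`EXP ⊄ io-SIZE(n^c)` for every fixed `c`** (Impagliazzo–Kabanets–Wigderson 2002, Thm. 2,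
with their almost-everywhere `SIZE`): for every `c` there is `L ∈ EXP` with `n^c < L.circuitSize n`
for all sufficiently large `n` — here `L` is Kannan's `L_{c+1} ∈ Σ₄ᵖ ⊆ EXP` (IKW take the
lexicographically first hard circuit instead). This is the statement of the named fact
`IKW2002_thm2` of the easy-witness decomposition. [cite: ImpagliazzoKabanetsWigderson2002, Thm. 2] -/
theorem exists_mem_EXP_eventually_lt_circuitSize (c : ℕ) :
    ∃ L ∈ EXP, ∀ᶠ n in atTop, n ^ c < L.circuitSize n :=
  ⟨Kannan.lang (c + 1), Kannan.lang_mem_EXP (c + 1), Kannan.eventually_pow_lt_circuitSize c⟩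

end Literature.Computability.Complexity
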